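import Summits.ResolutionOfSingularities.ResolutionOfSingularities.Theorems.EquisingularLiftEquisingularLiftNatOrdinaryPointVertexChart
import Summits.ResolutionOfSingularities.ResolutionOfSingularities.Theorems.EquisingularLiftEquisingularLiftNatHypersurfaceLinearCentreBlowupLocal
import Summits.ResolutionOfSingularities.ResolutionOfSingularities.Theorems.EquisingularLiftEquisingularLiftNatSpecimenConeChartsAllN
import Literature.AlgebraicGeometry.Motives.ProjectiveSpaceLinearSubspaces
import Literature.AlgebraicGeometry.Resolution.PointBlowupAlgebraCharts
import HarnessLib

/-!
# [OURS · L1 W4.5(b)] EL♮ FOR EVERY HYPERSURFACE WITH ONE ORDINARY MULTIPLE POINT (at a coordinate vertex), EVERY DIMENSION — T-ORD: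
# one blow-up of the point resolves (crux `Theses.EquisingularLift.EquisingularLiftNat`, stmt-ResolutionOfSingularities-20038)

NOT a statement of any manuscript; OURS kernel theorem (cell `res-hironaka`, chain w45b; seat res-D-pv-013, own initiative, counted 0). AI-written,
weaker than expert review. No definition, no `sorry`, standard axioms.

`F ∈ K[x₀,…,x_{m+2}]` a prime form vanishing at the vertex `P = [1:0:…:0]` whose vertex chart `F(x₀ := 1) = Φ + Ψ` has `Φ` a NONSINGULAR form of
degree `μ` (smooth projectivised tangent cone: `P` is an ORDINARY `μ`-fold point) and `Ψ ∈ (y)^{μ+1}`, and whose other affine charts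
`K[y]/(F(x_c := 1))`-rings `ChartRing F c`, `c ≠ 0`, are regular (so `P` is the only singular point). Then `H = V₊(F) ⊂ ℙ^{m+2}_K` satisfies
`ELNatAt p K (m+2) H ι` — `O = 𝕎(K)`, ONE blow-up of `ℙ^{m+2}_O` along the `O`-point through `P` (`elNatAt_of_linearCentreKill`, p535275); downstairs
every blow-up of `H` along `Λ·𝒪_H` (`Λ` = the vertex) is regular: `HypersurfaceSpecimen.isRegular_of_isBlowup_comap_of_charts_local` (p541657)
with the vertex chart `OrdPoint.isRegularLocalRing_localization_blowupAlgebra` (p544429, res-L1-w45b-stub-3's T-EBETA-PRIME ring core) transported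
along `ChartRing F 0 ≅ K[y]/(Φ + Ψ)`. Cones (`Ψ = 0`) are `ConeN.elNatAt_cone` (p537155); here every one-node hypersurface (`μ = 2`, `Φ` a nonsingular
quadric), every ordinary triple point, … in every dimension and characteristic.

* `OrdPoint.exists_X_succ_not_mem_of_not_mem_support` — off `supp Λ` some `x_c`, `c ≠ 0`, is invertible (the vertex `coordSubspacePoint` lies in
  `range Proj(f_k)`, whose closure is `V₊(x₁,…,x_{m+2})`);
* `OrdPoint.exists_X_succ_not_mem_span` — a prime form divides at most one variable up to units;
* `OrdPoint.isRegularLocalRing_stalk_of_chartRing` — regular chart ring ⇒ regular stalks over `D₊(x_c)`;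
* `OrdPoint.isRegularLocalRing_localization_blowupAlgebra_chartRing` — the vertex chart, transported to `ChartRing F 0`;
* **`OrdPoint.elNatAt_ordinaryPoint`**; `OrdPoint.elNatAt_cone_of_ordinaryPoint` — the cones (`Ψ = 0`) inhabit its hypothesis bundle (witness).

References: Hartshorne I Thm. 5.1, II Prop. 5.9; The Stacks Project 0804, 0BIQ; Görtz–Wedhorn I 13.96 — through the cited tree files.
-/

set_option linter.dupNamespace false -- mandated namespace `Summit.<Summit>.<Problem>` of this single-conjunct summit

noncomputable section

open CategoryTheory CategoryTheory.Limits AlgebraicGeometry TopologicalSpace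
open MvPolynomial HomogeneousLocalization
open Literature.AlgebraicGeometry.Resolution
open Literature.AlgebraicGeometry.Motives Literature.AlgebraicGeometry.Motives.SmoothHypersurface
open Literature.AlgebraicGeometry.Motives.ProjectiveSpace
open AlgebraicGeometry.Scheme.IdealSheafData
open Summit.ResolutionOfSingularities.ResolutionOfSingularities.Cruxes.EquisingularLift.StrataSplit

namespace Summit.ResolutionOfSingularities.ResolutionOfSingularities.Cruxes.EquisingularLiftNat.Sections

namespace OrdPoint

variable (k : Type) [Field k] {m : ℕ} (F : MvPolynomial (Fin (m + 2 + 1)) k) {d : ℕ} (hF : F.IsHomogeneous d) (hd : 0 < d)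
  (hFp : Prime F)

attribute [local instance] MvPolynomial.gradedAlgebra ProjBaseChange.algebraBase

/-! ## The vertex `Λ` and the charts off it -/

section Kill

variable (e : Fin 1 → Fin (m + 2 + 1)) (he0 : ∀ j, e j = 0)
  (fk : homogeneousSubmodule (Fin (m + 2 + 1)) k →+*ᵍ homogeneousSubmodule (Fin (0 + 1)) k)
  (hfk' : HomogeneousIdeal.irrelevant (homogeneousSubmodule (Fin (0 + 1)) k) ≤
    (HomogeneousIdeal.irrelevant (homogeneousSubmodule (Fin (m + 2 + 1)) k)).map fk)
  (hfkC : ∀ a : k, fk (C a) = C a) (hfke : ∀ j : Fin 1, fk (X (e j)) = X j)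
  (hfk0 : ∀ i : Fin (m + 2 + 1), i ∉ Set.range e → fk (X i) = 0)

include he0 hfkC hfke hfk0 in
/-- **Off `supp Λ` some `x_c`, `c ≠ 0`, does not vanish**: the vertex point `(x₁,…,x_{m+2})` (`coordSubspacePoint`) is `Proj(f_k)` of the point of
`ℙ⁰_k`, so its closure `V₊(x₁,…,x_{m+2})` lies in the (closed) support of `Λ = ker Proj(f_k)`. [cite: Hartshorne1977, II Prop. 2.5] -/
theorem exists_X_succ_not_mem_of_not_mem_support {x : Proj (homogeneousSubmodule (Fin (m + 2 + 1)) k)}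
    (hx : x ∉ ((Proj.map fk hfk').ker.support : Set (Proj (homogeneousSubmodule (Fin (m + 2 + 1)) k)))) :
    ∃ c : Fin (m + 2 + 1), c ≠ 0 ∧ (X c : MvPolynomial (Fin (m + 2 + 1)) k) ∉ x.asHomogeneousIdeal := by
  classical
  by_contra hall
  push Not at hall
  apply hx
  -- the vertex as a point of `ℙ^{m+2}` and its closure
  have hS : (Finset.univ.filter fun c : Fin (m + 2 + 1) => c ≠ 0) ≠ Finset.univ := by
    intro h
    have h0 := Finset.mem_univ (0 : Fin (m + 2 + 1))
    rw [← h, Finset.mem_filter] at h0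
    exact h0.2 rfl
  have hxcl : x ∈ closure {coordSubspacePoint (k := k) (Finset.univ.filter fun c : Fin (m + 2 + 1) => c ≠ 0) hS} := by
    rw [closure_coordSubspacePoint]
    refine (ProjectiveSpectrum.mem_zeroLocus _ _ _).mpr ?_
    rintro _ ⟨c, hc, rfl⟩
    have hc' : c ≠ 0 := (Finset.mem_filter.mp (Finset.mem_coe.mp hc)).2
    exact hall c hc'
  -- the vertex is `Proj(f_k)` of the point `(0)` of `ℙ⁰_k`
  haveI : IsClosedImmersion (Proj.map fk hfk') := LinearCentre.isClosedImmersion_projMap_kill e fk hfk' hfkC hfke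
  have hv : coordSubspacePoint (k := k) (Finset.univ.filter fun c : Fin (m + 2 + 1) => c ≠ 0) hS ∈ Set.range (Proj.map fk hfk') := by
    let y₀ : Proj (homogeneousSubmodule (Fin (0 + 1)) k) :=
      ⟨⊥, Ideal.isPrime_bot, fun h => by
        have hX : (X 0 : MvPolynomial (Fin (0 + 1)) k) ∈ HomogeneousIdeal.irrelevant (homogeneousSubmodule (Fin (0 + 1)) k) :=
          HomogeneousIdeal.mem_irrelevant_of_mem _ zero_lt_one (isHomogeneous_X k 0)
        have h0 : (X 0 : MvPolynomial (Fin (0 + 1)) k) ∈ (⊥ : HomogeneousIdeal (homogeneousSubmodule (Fin (0 + 1)) k)) := h hX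
        rw [← HomogeneousIdeal.mem_iff, HomogeneousIdeal.toIdeal_bot, Ideal.mem_bot] at h0
        exact X_ne_zero (R := k) (0 : Fin (0 + 1)) h0⟩
    refine ⟨y₀, ?_⟩
    apply ProjectiveSpectrum.ext
    apply HomogeneousIdeal.toIdeal_injective
    rw [LinearCentre.projMap_apply_asHomogeneousIdeal, HomogeneousIdeal.toIdeal_comap, toIdeal_coordSubspacePoint]
    change Ideal.comap fk.toRingHom ⊥ = _
    rw [← RingHom.ker_eq_comap_bot,
      LinearCentre.ker_kill e (Function.injective_of_subsingleton e) fk.toRingHom (fun a => hfkC a) (fun j => hfke j) (fun i hi => hfk0 i hi)]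
    congr 1
    ext q
    constructor
    · rintro ⟨c, hc, rfl⟩
      exact ⟨c, Finset.mem_coe.mpr (Finset.mem_filter.mpr ⟨Finset.mem_univ _, (ConeN.not_mem_range_iff (m := m) he0 c).mp hc⟩), rfl⟩
    · rintro ⟨c, hc, rfl⟩
      exact ⟨c, (ConeN.not_mem_range_iff (m := m) he0 c).mpr (Finset.mem_filter.mp (Finset.mem_coe.mp hc)).2, rfl⟩
  rw [LinearCentre.support_ker_eq_range e fk hfk' hfkC hfke]
  exact closure_minimal (Set.singleton_subset_iff.mpr hv) (Proj.map fk hfk').isClosedEmbedding.isClosed_range hxcl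

end Kill

include hFp in
/-- **A prime form lies in at most one of the ideals `(x_{a+1})`**: some `x_{a+1} ∉ (F)`. [folklore] -/
theorem exists_X_succ_not_mem_span : ∃ a : Fin (m + 2), (X a.succ : MvPolynomial (Fin (m + 2 + 1)) k) ∉ Ideal.span {F} := by
  by_contra h
  push Not at h
  have h1 : F ∣ X (Fin.succ 0) := Ideal.mem_span_singleton.mp (h 0)
  have h2 : F ∣ X (Fin.succ 1) := Ideal.mem_span_singleton.mp (h 1)
  have a1 := hFp.irreducible.associated_of_dvd (X_prime (i := (Fin.succ 0 : Fin (m + 2 + 1))) (R := k)).irreducible h1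
  have a2 := hFp.irreducible.associated_of_dvd (X_prime (i := (Fin.succ 1 : Fin (m + 2 + 1))) (R := k)).irreducible h2
  have hdvd := (a1.symm.trans a2).dvd
  rw [X_dvd_X] at hdvd
  exact absurd (Fin.succ_injective _ hdvd) (by simp)

include hd in
/-- **Regular chart ring ⇒ regular stalks over `D₊(x_c)`** (the chart `Spec (ChartRing F c) → H` is an open immersion). [cite: StacksProject, Tag 02IS] -/
theorem isRegularLocalRing_stalk_of_chartRing (c : Fin (m + 2 + 1)) (hc : IsRegularRing (ChartRing F c hF)) (x : (hypersurface F).left)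
    (hx : (hypersurfaceι F).left x ∈ Proj.basicOpen (homogeneousSubmodule (Fin (m + 2 + 1)) k) (X c)) :
    IsRegularLocalRing ((hypersurface F).left.presheaf.stalk x) := by
  have hx' : x ∈ Set.range (chart F c hF hd).left := by
    rw [range_chart_left]
    exact hx
  obtain ⟨y, rfl⟩ := hx'
  haveI := hc
  haveI := isOpenImmersion_chart_left F c hF hd
  have hy : IsRegularLocalRing ((specOver k (ChartRing F c hF)).left.presheaf.stalk y) :=
    Scheme.isRegular_Spec (CommRingCat.of (ChartRing F c hF)) y
  exact IsRegularLocalRing.of_ringEquiv (asIso ((chart F c hF hd).left.stalkMap y)).commRingCatIsoToRingEquiv.symm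

/-! ## The vertex chart, transported to `ChartRing F 0` -/

/-- **THE VERTEX CHART OF AN ORDINARY POINT, on `ChartRing F 0`**: if `F(x₀ := 1) = Φ + Ψ` with `Φ` a nonsingular form of degree `μ` and
`Ψ ∈ (y)^{μ+1}`, `(Φ + Ψ)` radical, then for the centre `I = (x_a/x₀ : a ≠ 0)` of `ChartRing F 0` and `b = x_a/x₀` the localisations of
`(ChartRing F 0)[I/b]` at the primes containing `b` are regular — `OrdPoint.isRegularLocalRing_localization_blowupAlgebra` transported along
`ChartRing F 0 ≅ K[y]/(Φ + Ψ)` (`HypersurfaceSpecimen.exists_chartQuotEquiv`, `blowupAlgebra.congrEquiv`). [cite: StacksProject, Tag 0BIQ] -/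
theorem isRegularLocalRing_localization_blowupAlgebra_chartRing {e : Fin 1 → Fin (m + 2 + 1)} (he0 : ∀ j, e j = 0)
    (Φ Ψ : MvPolynomial (Fin (m + 2)) k) {μ : ℕ} (hΦ : Φ.IsHomogeneous μ) (hns : IsNonsingularForm k Φ)
    (hΨ : Ψ ∈ Ideal.span (Set.range (X : Fin (m + 2) → MvPolynomial (Fin (m + 2)) k)) ^ (μ + 1))
    (hdeh : dehomogenize k (0 : Fin (m + 2 + 1)) F = Φ + Ψ) (hrad : (Ideal.span {Φ + Ψ}).radical = Ideal.span {Φ + Ψ})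
    (a : {a : Fin (m + 2 + 1) // a ∉ Set.range e})
    (𝔐 : Ideal (blowupAlgebra (Ideal.span (Set.range fun a' : {a' : Fin (m + 2 + 1) // a' ∉ Set.range e} => tautVec F 0 hF a'.1))
      (tautVec F 0 hF a.1))) [𝔐.IsPrime]
    (h𝔐 : algebraMap (ChartRing F 0 hF) (blowupAlgebra (Ideal.span (Set.range fun a' : {a' : Fin (m + 2 + 1) // a' ∉ Set.range e} =>
      tautVec F 0 hF a'.1)) (tautVec F 0 hF a.1)) (tautVec F 0 hF a.1) ∈ 𝔐) :
    IsRegularLocalRing (Localization.AtPrime 𝔐) := by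
  obtain ⟨θ, hθ⟩ := HypersurfaceSpecimen.exists_chartQuotEquiv F hF 0 (Φ + Ψ) hdeh hrad
  simp only [Fin.succAbove_zero] at hθ
  have ha0 : a.1 ≠ 0 := (ConeN.not_mem_range_iff (m := m) he0 a.1).mp a.2
  obtain ⟨l₀, hl₀⟩ : ∃ j : Fin (m + 2), Fin.succ j = a.1 := Fin.exists_succ_eq.mpr ha0
  -- the centre and the generator under `θ`
  have hrange : Set.range (⇑θ.toRingHom ∘ fun a' : {a' : Fin (m + 2 + 1) // a' ∉ Set.range e} => tautVec F 0 hF a'.1) =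
      Set.range (⇑(Ideal.Quotient.mk (Ideal.span {Φ + Ψ})) ∘ (MvPolynomial.X : Fin (m + 2) → MvPolynomial (Fin (m + 2)) k)) := by
    ext q
    constructor
    · rintro ⟨⟨a', ha'⟩, rfl⟩
      obtain ⟨i, rfl⟩ : ∃ i : Fin (m + 2), Fin.succ i = a' :=
        Fin.exists_succ_eq.mpr ((ConeN.not_mem_range_iff (m := m) he0 a').mp ha')
      exact ⟨i, (hθ i).symm⟩
    · rintro ⟨i, rfl⟩
      exact ⟨⟨i.succ, (ConeN.not_mem_range_iff (m := m) he0 _).mpr (Fin.succ_ne_zero i)⟩, hθ i⟩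
  have hIθ : (Ideal.span (Set.range fun a' : {a' : Fin (m + 2 + 1) // a' ∉ Set.range e} => tautVec F 0 hF a'.1)).map θ.toRingHom = (Ideal.span (Set.range (X : Fin (m + 2) → MvPolynomial (Fin (m + 2)) k))).map
      (Ideal.Quotient.mk (Ideal.span {Φ + Ψ})) := by
    rw [Ideal.map_span, Ideal.map_span, ← Set.range_comp, hrange, Set.range_comp]
  have hbθ : θ (tautVec F 0 hF a.1) = Ideal.Quotient.mk (Ideal.span {Φ + Ψ}) (X l₀) := by
    rw [← hl₀]
    exact hθ l₀
  -- the vertex chart statement for arbitrary indices equal to the transported ones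
  have key : ∀ (J : Ideal (MvPolynomial (Fin (m + 2)) k ⧸ Ideal.span {Φ + Ψ})) (c : MvPolynomial (Fin (m + 2)) k ⧸ Ideal.span {Φ + Ψ}),
      J = (Ideal.span (Set.range (X : Fin (m + 2) → MvPolynomial (Fin (m + 2)) k))).map (Ideal.Quotient.mk (Ideal.span {Φ + Ψ})) →
      c = Ideal.Quotient.mk (Ideal.span {Φ + Ψ}) (X l₀) →
      ∀ (𝔑 : Ideal (blowupAlgebra J c)) [𝔑.IsPrime], algebraMap _ (blowupAlgebra J c) c ∈ 𝔑 →
        IsRegularLocalRing (Localization.AtPrime 𝔑) := by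
    rintro J c rfl rfl 𝔑 _ h𝔑
    exact isRegularLocalRing_localization_blowupAlgebra k Φ hΦ hns Ψ hΨ l₀ 𝔑 h𝔑
  -- transport along `congrEquiv θ`
  let η := blowupAlgebra.congrEquiv θ (Ideal.span (Set.range fun a' : {a' : Fin (m + 2 + 1) // a' ∉ Set.range e} => tautVec F 0 hF a'.1)) (tautVec F 0 hF a.1)
  obtain ⟨𝔑, h𝔑⟩ : ∃ P, P = 𝔐.comap η.symm.toRingHom := ⟨_, rfl⟩
  haveI : 𝔑.IsPrime := by rw [h𝔑]; exact Ideal.comap_isPrime _ 𝔐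
  have h𝔑mem : algebraMap _ (blowupAlgebra ((Ideal.span (Set.range fun a' : {a' : Fin (m + 2 + 1) // a' ∉ Set.range e} => tautVec F 0 hF a'.1)).map θ.toRingHom) (θ (tautVec F 0 hF a.1))) (θ (tautVec F 0 hF a.1)) ∈ 𝔑 := by
    rw [h𝔑, Ideal.mem_comap]
    change η.symm _ ∈ 𝔐
    rw [blowupAlgebra.congrEquiv_symm_algebraMap, RingEquiv.symm_apply_apply]
    exact h𝔐
  have hreg := key _ _ hIθ hbθ 𝔑 h𝔑mem
  exact isRegularLocalRing_localization_of_ringEquiv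
    (C := blowupAlgebra ((Ideal.span (Set.range fun a' : {a' : Fin (m + 2 + 1) // a' ∉ Set.range e} => tautVec F 0 hF a'.1)).map θ.toRingHom) (θ (tautVec F 0 hF a.1)))
    (D := blowupAlgebra (Ideal.span (Set.range fun a' : {a' : Fin (m + 2 + 1) // a' ∉ Set.range e} => tautVec F 0 hF a'.1)) (tautVec F 0 hF a.1)) η.symm 𝔑 𝔐 (fun y => by rw [h𝔑, Ideal.mem_comap]; rfl) hreg

/-! ## EL♮ for hypersurfaces with one ordinary multiple point -/

/-- **EL♮ HOLDS FOR EVERY HYPERSURFACE WITH ONE ORDINARY MULTIPLE POINT AT A COORDINATE VERTEX, IN EVERY DIMENSION.** `K` algebraically closed of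
characteristic `p`; `F ∈ K[x₀,…,x_{m+2}]` a prime form with `F ∈ (x₁,…,x_{m+2})` (the vertex `P = [1:0:…:0]` lies on `H = V₊(F)`), vertex chart
`F(x₀ := 1) = Φ + Ψ` with `Φ` a NONSINGULAR form of degree `μ` (`IsNonsingularForm`: the projectivised tangent cone at `P` is smooth — `P` is an
ORDINARY `μ`-fold point) and `Ψ ∈ (y)^{μ+1}`, and regular chart rings `ChartRing F c`, `c ≠ 0` (`H ∖ P` regular). Then
`Theorems.EquisingularLift.ELNatAt p K (m+2) H ι` (p503491): `O = 𝕎(K)`, ONE blow-up of `ℙ^{m+2}_O` along the `O`-point through `P`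
(`elNatAt_of_linearCentreKill`); downstairs `HypersurfaceSpecimen.isRegular_of_isBlowup_comap_of_charts_local` with the vertex chart above. Covers every
one-node hypersurface (`μ = 2`), every ordinary triple point, …; the cones `Ψ = 0` are `ConeN.elNatAt_cone`. [OURS · L1 W4.5b] [folklore] -/
theorem elNatAt_ordinaryPoint (p : ℕ) (hp : p.Prime) (K : Type) [Field K] [CharP K p] [IsAlgClosed K] {m : ℕ}
    (F : MvPolynomial (Fin (m + 2 + 1)) K) {d : ℕ} (hF : F.IsHomogeneous d) (hFp : Prime F)
    (hFmem : F ∈ Ideal.span (Set.range fun j : Fin (m + 2) => (X j.succ : MvPolynomial (Fin (m + 2 + 1)) K)))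
    (Φ Ψ : MvPolynomial (Fin (m + 2)) K) {μ : ℕ} (hΦ : Φ.IsHomogeneous μ) (hns : IsNonsingularForm K Φ)
    (hΨ : Ψ ∈ Ideal.span (Set.range (X : Fin (m + 2) → MvPolynomial (Fin (m + 2)) K)) ^ (μ + 1))
    (hdeh : dehomogenize K (0 : Fin (m + 2 + 1)) F = Φ + Ψ) (hrad : (Ideal.span {Φ + Ψ}).radical = Ideal.span {Φ + Ψ})
    (hoff : ∀ c : Fin (m + 2 + 1), c ≠ 0 → IsRegularRing (ChartRing F c hF)) :
    Theorems.EquisingularLift.ELNatAt p K (m + 2) (hypersurface F).left (hypersurfaceι F).left := by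
  classical
  have hd : 0 < d := ConeN.pos_of_prime_of_isHomogeneous K F hF hFp
  let e : Fin 1 → Fin (m + 2 + 1) := fun _ => 0
  have he0 : ∀ j, e j = 0 := fun _ => rfl
  have he : Function.Injective e := Function.injective_of_subsingleton e
  obtain ⟨fk, hfk', hfkC, hfke, hfk0⟩ := LinearCentre.exists_kill (R := K) e he
  haveI := HypersurfaceSpecimen.isIntegral_hypersurface_of_prime K F hF hFp
  refine elNatAt_of_linearCentreKill p hp K e he _ (hypersurfaceι F).left fk hfk' hfkC hfke hfk0 ?_ ?_ ?_
  · -- `V(Λ) ⊆ ι(H)`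
    intro x hx
    have hX : ∀ j : Fin (m + 2), (X j.succ : MvPolynomial (Fin (m + 2 + 1)) K) ∈ x.asHomogeneousIdeal := fun j =>
      LinearCentre.X_mem_asHomogeneousIdeal_of_mem_support e fk hfk' hfkC hfke hfk0 hx
        ((ConeN.not_mem_range_iff (m := m) he0 _).mpr (Fin.succ_ne_zero j))
    refine (Set.ext_iff.mp (range_hypersurfaceι F) x).mpr ((ProjectiveSpectrum.mem_zeroLocus _ _ _).mpr (Set.singleton_subset_iff.mpr ?_))
    change F ∈ x.asHomogeneousIdeal
    exact (Ideal.span_le.mpr (Set.range_subset_iff.mpr hX)) hFmem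
  · -- `ι(H) ⊄ V(Λ)`
    intro h
    have hmem : (pointOfPrime F hF hFp : Proj (homogeneousSubmodule (Fin (m + 2 + 1)) K)) ∈ Set.range (hypersurfaceι F).left := by
      refine (Set.ext_iff.mp (range_hypersurfaceι F) _).mpr ((ProjectiveSpectrum.mem_zeroLocus _ _ _).mpr (Set.singleton_subset_iff.mpr ?_))
      exact Ideal.subset_span rfl
    obtain ⟨a, ha⟩ := exists_X_succ_not_mem_span K F hFp
    exact ha (LinearCentre.X_mem_asHomogeneousIdeal_of_mem_support e fk hfk' hfkC hfke hfk0 (h hmem)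
      ((ConeN.not_mem_range_iff (m := m) he0 _).mpr (Fin.succ_ne_zero a)))
  · -- every blow-up of `H` along `Λ·𝒪_H` is regular
    intro Z ρ hρ
    refine HypersurfaceSpecimen.isRegular_of_isBlowup_comap_of_charts_local K F hF hd e he fk hfk' hfkC hfke hfk0
      (fun x hx => ?_) (fun c hc a 𝔐 _ h𝔐 => ?_) Z ρ hρ
    · obtain ⟨c, hc0, hc⟩ := exists_X_succ_not_mem_of_not_mem_support K e he0 fk hfk' hfkC hfke hfk0 hx
      exact isRegularLocalRing_stalk_of_chartRing K F hF hd c (hoff c hc0) x ((Proj.mem_basicOpen _ _ _).mpr hc)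
    · obtain ⟨j, rfl⟩ := hc
      exact isRegularLocalRing_localization_blowupAlgebra_chartRing K F hF he0 Φ Ψ hΦ hns hΨ hdeh hrad a 𝔐 h𝔐

/-- **Witness / consistency check: the cones are ordinary points with `Ψ = 0`.** For a prime form `G ∈ K[T₀,…,T_{m+1}]` with regular idle-variable
charts and `IsNonsingularForm K G`, the cone `V₊(G(x₁,…,x_{m+2}))` satisfies every hypothesis of `elNatAt_ordinaryPoint` (`F(x₀:=1) = G + 0`,
`hoff` = `ConeN.isRegularRing_chartRing_of_ne_zero`) — a second derivation of `ConeN.elNatAt_cone` (p537155) showing the hypothesis bundle of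
`elNatAt_ordinaryPoint` is inhabited in every dimension. [OURS · L1 W4.5b] [folklore] -/
theorem elNatAt_cone_of_ordinaryPoint (p : ℕ) (hp : p.Prime) (K : Type) [Field K] [CharP K p] [IsAlgClosed K] {m : ℕ}
    (G : MvPolynomial (Fin (m + 2)) K) {d : ℕ} (hG : G.IsHomogeneous d) (hGp : Prime G) (hns : IsNonsingularForm K G)
    (hreg : ∀ i : Fin (m + 2), IsRegularRing (MvPolynomial (Fin (m + 2)) K ⧸
      Ideal.span {aeval (Function.update (X : Fin (m + 2) → MvPolynomial (Fin (m + 2)) K) i 1) G})) :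
    Theorems.EquisingularLift.ELNatAt p K (m + 2) (hypersurface (rename Fin.succ G : MvPolynomial (Fin (m + 2 + 1)) K)).left
      (hypersurfaceι (rename Fin.succ G : MvPolynomial (Fin (m + 2 + 1)) K)).left := by
  have hF : (rename Fin.succ G : MvPolynomial (Fin (m + 2 + 1)) K).IsHomogeneous d := ConeN.isHomogeneous_rename_succ K G hG
  have hd : 0 < d := ConeN.pos_of_prime_of_isHomogeneous K G hG hGp
  have hrad : (Ideal.span {G + 0}).radical = Ideal.span {G + 0} := by
    rw [add_zero]
    exact ((Ideal.span_singleton_prime hGp.ne_zero).mpr hGp).radical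
  refine elNatAt_ordinaryPoint p hp K (rename Fin.succ G : MvPolynomial (Fin (m + 2 + 1)) K) hF (ConeN.prime_rename_succ K G hGp)
    (ConeN.rename_succ_mem_span_X_succ K G hG hd) G 0 hG hns (Ideal.zero_mem _) ?_ hrad
    (fun c hc => ConeN.isRegularRing_chartRing_of_ne_zero K G hF hreg c hc)
  rw [add_zero]
  exact ConeN.dehomogenize_zero_rename_succ K G

/-- A form of positive degree has no constant term: it lies in `(y)`. [folklore] -/
theorem mem_span_X_of_isHomogeneous (K : Type) [Field K] {σ : Type} (Φ : MvPolynomial σ K) {μ : ℕ} (hΦ : Φ.IsHomogeneous μ) (hμ : 1 ≤ μ) :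
    Φ ∈ Ideal.span (Set.range (X : σ → MvPolynomial σ K)) := by
  classical
  have hΦ0 : Φ.coeff 0 = 0 := hΦ.coeff_eq_zero (by
    rw [map_zero]
    omega)
  rw [← Set.image_univ, MvPolynomial.mem_ideal_span_X_image]
  intro s hs
  have hs0 : s ≠ 0 := by
    rintro rfl
    exact (mem_support_iff.mp hs) hΦ0
  obtain ⟨j, hj⟩ := Finsupp.ne_iff.mp hs0
  exact ⟨j, Set.mem_univ _, hj⟩

/-- **`(F(x₀ := 1))` is radical** for a prime form `F` with vertex chart `Φ + Ψ` (`μ ≥ 1`): `F(x₀:=1)` is irreducible or a unit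
(tree `irreducible_or_isUnit_dehomogenize`), and not a unit since it lies in `(y)`. [cite: Hartshorne1977, I §2, Ex. 2.10] -/
theorem radical_span_dehomogenize_eq (K : Type) [Field K] {m : ℕ} (F : MvPolynomial (Fin (m + 2 + 1)) K) {d : ℕ} (hF : F.IsHomogeneous d)
    (hFp : Prime F) (Φ Ψ : MvPolynomial (Fin (m + 2)) K) {μ : ℕ} (hΦ : Φ.IsHomogeneous μ) (hμ : 1 ≤ μ)
    (hΨ : Ψ ∈ Ideal.span (Set.range (X : Fin (m + 2) → MvPolynomial (Fin (m + 2)) K)) ^ (μ + 1))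
    (hdeh : dehomogenize K (0 : Fin (m + 2 + 1)) F = Φ + Ψ) : (Ideal.span {Φ + Ψ}).radical = Ideal.span {Φ + Ψ} := by
  have hmem : Φ + Ψ ∈ Ideal.span (Set.range (X : Fin (m + 2) → MvPolynomial (Fin (m + 2)) K)) :=
    Ideal.add_mem _ (mem_span_X_of_isHomogeneous K Φ hΦ hμ) (Ideal.pow_le_self (by omega) hΨ)
  have hnu : ¬ IsUnit (Φ + Ψ) := by
    intro hu
    haveI := ConeN.isDomain_quotient_origin K (N := m + 1)
    have htop := Ideal.eq_top_of_isUnit_mem _ hmem hu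
    have hprime : (Ideal.span (Set.range (X : Fin (m + 2) → MvPolynomial (Fin (m + 2)) K))).IsPrime :=
      (Ideal.Quotient.isDomain_iff_prime _).mp (ConeN.isDomain_quotient_origin K (N := m + 1))
    exact hprime.ne_top htop
  have hirr : Irreducible (Φ + Ψ) := by
    rw [← hdeh] at hnu ⊢
    exact (irreducible_or_isUnit_dehomogenize (i := (0 : Fin (m + 2 + 1))) hF hFp.irreducible).resolve_right hnu
  exact ((Ideal.span_singleton_prime hirr.ne_zero).mpr hirr.prime).radical

/-- **T-ORD without the radicality hypothesis** (`μ ≥ 1` instead): the vertex chart equation `F(x₀ := 1) = Φ + Ψ` of a prime form is automatically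
radical (`radical_span_dehomogenize_eq`). [OURS · L1 W4.5b] [folklore] -/
theorem elNatAt_ordinaryPoint' (p : ℕ) (hp : p.Prime) (K : Type) [Field K] [CharP K p] [IsAlgClosed K] {m : ℕ}
    (F : MvPolynomial (Fin (m + 2 + 1)) K) {d : ℕ} (hF : F.IsHomogeneous d) (hFp : Prime F)
    (hFmem : F ∈ Ideal.span (Set.range fun j : Fin (m + 2) => (X j.succ : MvPolynomial (Fin (m + 2 + 1)) K)))
    (Φ Ψ : MvPolynomial (Fin (m + 2)) K) {μ : ℕ} (hΦ : Φ.IsHomogeneous μ) (hμ : 1 ≤ μ) (hns : IsNonsingularForm K Φ)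
    (hΨ : Ψ ∈ Ideal.span (Set.range (X : Fin (m + 2) → MvPolynomial (Fin (m + 2)) K)) ^ (μ + 1))
    (hdeh : dehomogenize K (0 : Fin (m + 2 + 1)) F = Φ + Ψ)
    (hoff : ∀ c : Fin (m + 2 + 1), c ≠ 0 → IsRegularRing (ChartRing F c hF)) :
    Theorems.EquisingularLift.ELNatAt p K (m + 2) (hypersurface F).left (hypersurfaceι F).left :=
  elNatAt_ordinaryPoint p hp K F hF hFp hFmem Φ Ψ hΦ hns hΨ hdeh (radical_span_dehomogenize_eq K F hF hFp Φ Ψ hΦ hμ hΨ hdeh) hoff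

end OrdPoint

end Summit.ResolutionOfSingularities.ResolutionOfSingularities.Cruxes.EquisingularLiftNat.Sections

end
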